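/-
Copyright (c) 2026 the pub-hodgecm-mathlib formalisation cell (harness21).  Prover seat hodgecm-mathlib-K2E1-p14 (g4), Track B ∕ K2-LIT, h413 = `stmt-HodgeConjecture-24833`,
R90-TF section S8 «ContSpec-n½», the (M) socket road (B ED. 7 :299, K2E1-p10's censuses `CENSUS-M-sock299.K2E1-p10-g5.md` item (M-d) and
`CENSUS-M-FILE1-IsPiNOfLetters.K2E1-p10-g6.md` item 6): the STATEMENT FILE of the split-place letter (M-d) «SPLIT-LQ» (S8 dealer R90-CS-plan (g3) S8-R217 (4)) — the
Langlands-quotient identification at a place of `L⁺` split in `L`, as a named predicate + the consumer-shaped theorem the (SPLIT) letter of (M) FILE 1 binds by name.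
-/
import Literature.NumberTheory.Automorphic.ParabolicIndGLOneLinkLanglandsQuotient  -- ★ p864492 THE NAMED FACT `Zelevinsky1980.parabolicIndGL_three_oneLink_quotient_equiv_detChar` (SPLIT-LQ on `GL₃(F)`)
import Literature.NumberTheory.Rogawski1990.CMLocalAPacketMembers            -- ★ `splitMemberGL`, `cmSplitEquiv`, `cmSplitPacket`, `cmSplitPacket_members`, `cmSplitPacket_πn`
import Literature.NumberTheory.Automorphic.IrreducibleClassesComap           -- ★ `SmoothIrrep.comap`, `IrrClass.comap`, `IrrClass.comap_mk`, `IrrClass.comap_comap_symm`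
import HarnessLib

/-!
# S8 (M)-road letter (M-d) «SPLIT-LQ» — `R90S8SplitPlaceLanglandsQuotientU3Statement`: AT A SPLIT PLACE, EVERY IRREDUCIBLE QUOTIENT OF THE `GL₃(L_w)` PRINCIPAL SERIES
# `ν₀ν^{1∕2} × χ′ × ν₀ν^{-1∕2}` IS `i_{Q_{2,1}}((ν₀ ∘ det₂) ⊠ χ′) = splitMemberGL ν₀ χ′` — STATEMENT (named predicate) + CONSUMER-SHAPED THEOREM

Track B ∕ K2-LIT, crux h413 = `stmt-HodgeConjecture-24833`, route of record `HCCMUnconditional`; cell `hodgecm-mathlib`, R90-TF programme, section S8 «ContSpec-n½», the (M) road to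
socket :299 (`res_middleResidue_isPiN`): at a finite place `v` of `L⁺` SPLIT in `L` (`w ∣ v`, `w̄ ≠ w`) the local group is `G′_v ≃ₜ* GL₃(L_w)` (★ `cmSplitEquiv`), the local
A-packet is the singleton `Π(ξ_v) = {⟦splitMemberGL ν₀ χ′ ∘ cmSplitEquiv⟧}` (★ `cmSplitPacket`, `ν₀ = ξ.splitν₀ μω w = η_wψ_wμ_w`, `χ′ = ξ.locψ w = ψ_w`), and the local component
of the residual block is an irreducible QUOTIENT of the principal series of `GL₃(L_w)` at the residual exponent — the image under `w` of the `U(2,1)` Borel datum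
`diag(α, β, ᾱ⁻¹) ↦ η ψ μ(α)‖α‖^{z₀} · ψ(β)`, i.e. the normalised induction from the upper-triangular Borel of the REGULAR triple **`(ν₀ν^{1∕2}, χ′, ν₀ν^{-1∕2})`** (`ν = ‖·‖_w`;
exponents `½ > 0 > −½` decreasing = the standard-module order).  (M-d) «SPLIT-LQ» is the local statement that identifies that quotient:
**every irreducible quotient of `ν₀ν^{1∕2} × χ′ × ν₀ν^{-1∕2}` is isomorphic to `(ν₀ ∘ det_{GL₂}) × χ′ = splitMemberGL ν₀ χ′`** (Zelevinsky: the linked pair `{ν₀ν^{-1∕2}} → {ν₀ν^{1∕2}}`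
taken in DEcreasing order has the segment representation `⟨[ν₀ν^{-1∕2}, ν₀ν^{1∕2}]⟩ = ν₀ ∘ det₂` as its unique irreducible QUOTIENT and `ν₀ ⊗ St₂` as its unique irreducible
subrepresentation; `χ′` unitary is linked to neither, so `× χ′` is exact, commutes past both, and preserves irreducibility [Zelevinsky1980, Thm. 4.2, Thm. 6.1 (a), §3.2 Ex.];
equivalently the Langlands quotient of the standard module `i_B(ν₀ν^{1∕2} ⊗ χ′ ⊗ ν₀ν^{-1∕2})` [BernsteinZelevinsky1977, §2.3, Thm. 2.9]; Rogawski's `i_G(ξ_v ⊗ μ_w ∘ det₀)` at a split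
place [Rogawski1990, Lemma 4.13.1 (b), §13.1 p. 199]).  THE LETTER is the Literature named fact ★ p864492 (typed by this seat for this purpose); THIS FILE proves the TRANSPORT to `G′_v`: under SPLIT-LQ, an irreducible smooth representation of `G′_v` whose transport to `GL₃(L_w)` is a
quotient of that principal series lies in `Π(ξ_v)`.  The payer of the predicate is either a Literature letter [Zelevinsky1980] or the tree's own `GL₃` exponent calculus
(★ `K2E3GL3OneLinkGeneric*`, `K2E3GL3StandardModule*`: case C1 «one link, generic third letter», class_B quotient) — not this file.
CURRENCY (= the K2E3 `GL₃` files'): `I θ = Representation.parabolicIndGL F id (𝟙.twist (∏ a, θ a ∘ det ∘ ev_a))`, `ν^{1∕2} = (unramifiedTwist F (1/2) : QuasiChar F).toMonoidHom`,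
irreducible quotient = a SURJECTIVE `Representation.IntertwiningMap` onto `π.ρ`, `π : SmoothIrrep`, classes in ★ `IrrClass`.  NO `sorry`, no `def`, no `instance`, no `notation`; default heartbeats; lane `--supports stmt-HodgeConjecture-24833 --as helper` (count-neutral).  CLOSES NO SOCKET.
* THE LETTER ITSELF is ★ p864492 `Literature/NumberTheory/Automorphic/ParabolicIndGLOneLinkLanglandsQuotient.lean`:
  **`Zelevinsky1980.parabolicIndGL_three_oneLink_quotient_equiv_detChar : Prop`** — «for every non-archimedean local `F` and unitary continuous `ν₀, χ′`, every irreducible `π` with a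
  surjective intertwining map `I ![ν₀ν^{1∕2}, χ′, ν₀ν^{-1∕2}] → π` is `≅ i_{Q_{2,1}}((ν₀ ∘ det₂) ⊠ χ′)`» (D-0014 named fact [Zelevinsky1980, Thm. 6.1 (a), Thm. 4.2, §3.2 Ex., 9.1]; its
  `_holds` is the payer's, in-tree road = ★ `K2E3GL3OneLinkGeneric*`); `(splitMemberGL F ν₀ χ′).ρ` IS that induced representation (`rfl`).
* **`irrClass_mk_eq_cmSplitPacket_πn_of_oneLinkQuotient`**, **`irrClass_mk_mem_cmSplitPacket_members_of_oneLinkQuotient`** (CONDITIONAL on the letter by design) — CONSUMER SHAPE for the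
  (SPLIT) letter of (M) FILE 1: for `π : SmoothIrrep G′_v` with `π ∘ cmSplitEquiv⁻¹` an irreducible quotient of the principal series, `⟦π⟧ = Π(ξ_v).πn ∈ Π(ξ_v).members`
  (★ `IrrClass.comap_comap_symm`, `comap_mk`, `cmSplitPacket_πn`, `cmSplitPacket_members`).
HONEST LABEL: HC_CM is proved only modulo the 7 printed citations (2 remaining named inputs: hLiu418 = `stmt-HodgeConjecture-24832`, h413 = `stmt-HodgeConjecture-24833`) until
rung 0 closes; REL ≠ ★ ≠ BUILT; a statement file pays nothing: SPLIT-LQ stays a LETTER until its payer lands; §2 is CONDITIONAL on it by design; count-neutral.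

## References
* [Zelevinsky1980] A. V. Zelevinsky, *Induced representations of reductive 𝔭-adic groups II. On irreducible representations of GL(n)*, Ann. Sci. ÉNS 13 (1980), §3.2 Example
  (`⟨[ρ, νρ]⟩ = ρν^{1∕2} ∘ det`), Thm. 4.2 (irreducibility of products of unlinked segments), Thm. 6.1 (a) (unique irreducible subrepresentation of `⟨Δ₁⟩ × ⋯ × ⟨Δ_r⟩`), §4.2.
* [BernsteinZelevinsky1977] I. N. Bernstein, A. V. Zelevinsky, *Induced representations of reductive 𝔭-adic groups I*, Ann. Sci. ÉNS 10 (1977), §2.3, Thm. 2.9 (exactness,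
  contragredient of an induced representation).
* [Rogawski1990] J. D. Rogawski, *Automorphic Representations of Unitary Groups in Three Variables* (1990), Lemma 4.13.1 (b), §12.2, §13.1 p. 199 (split places: `Π(ξ_v) = {i_G(ξ_v)}`).
-/

set_option autoImplicit false
set_option linter.dupNamespace false  -- the mandated namespace `…HodgeConjecture.HodgeConjecture.R90.S8` (LEAD #1 L1) repeats the summit's segment

noncomputable section

open NumberField IsDedekindDomain
open Literature.NumberTheory.Automorphic Literature.NumberTheory.Rogawski1990 Literature.NumberTheory.GaloisRepresentations
open Literature.NumberTheory.GaloisRepresentations.IsNonarchimedeanLocalField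
open scoped Matrix MatrixGroups

namespace Summit.HodgeConjecture.HodgeConjecture.R90.S8


/-! ## The consumer shape at a split place of the CM datum: transport of SPLIT-LQ to `G′_v` through `cmSplitEquiv` -/

section CM

variable (L : Type) [Field L] [NumberField L] [IsCMField L] (H' : Matrix (Fin 3) (Fin 3) L) (hH' : (H'.map (cmConjRingHom L))ᵀ = H') (hH'd : IsUnit H'.det)
  (v : HeightOneSpectrum (𝓞 ↥(maximalRealSubfield L))) (w : UnitaryGroup.PlacesOver L v) (hw : IsCMField.complexConj L • w.1 ≠ w.1)

/-- **CONSUMER SHAPE, class form**: under SPLIT-LQ (the named fact ★ `Zelevinsky1980.parabolicIndGL_three_oneLink_quotient_equiv_detChar`), an irreducible smooth representation `π` of `G′_v = U(H′)(L⁺_v)` whose transport `π ∘ cmSplitEquiv⁻¹` to `GL₃(L_w)` is an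
irreducible quotient of the principal series `I ![ν₀ν^{1∕2}, χ′, ν₀ν^{-1∕2}]` has class `Π(ξ_v).πn = ⟦splitMemberGL ν₀ χ′ ∘ cmSplitEquiv⟧` (★ `cmSplitPacket_πn`; transport by ★ `IrrClass.comap_mk`,
`IrrClass.comap_comap_symm`). [cite: Rogawski1990, §13.1 p. 199; Lemma 4.13.1 (b)] [cite: Zelevinsky1980, Thm. 6.1 (a)] -/
theorem irrClass_mk_eq_cmSplitPacket_πn_of_oneLinkQuotient
    (ν₀ χ' : (w.1.adicCompletion L)ˣ →* ℂˣ) (hν₀u : ∀ x, ‖((ν₀ x : ℂˣ) : ℂ)‖ = 1) (hν₀c : Continuous fun x => ((ν₀ x : ℂˣ) : ℂ))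
    (hχ'u : ∀ x, ‖((χ' x : ℂˣ) : ℂ)‖ = 1) (hχ'c : Continuous fun x => ((χ' x : ℂˣ) : ℂ))
    (hLQ : Zelevinsky1980.parabolicIndGL_three_oneLink_quotient_equiv_detChar)
    (π : SmoothIrrep ((UnitaryGroup.cmDatum L 3 H').Local v))
    (q : (Representation.parabolicIndGL (w.1.adicCompletion L) (id : Fin 3 → Fin 3)
      ((Representation.trivial ℂ (Π a : Fin 3, GL {i : Fin 3 // (id : Fin 3 → Fin 3) i = a} (w.1.adicCompletion L)) ℂ).twist
        (∏ a : Fin 3, ((![ν₀ * ((unramifiedTwist (w.1.adicCompletion L) (1 / 2) : QuasiChar (w.1.adicCompletion L)).toMonoidHom), χ',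
              ν₀ * ((unramifiedTwist (w.1.adicCompletion L) (1 / 2) : QuasiChar (w.1.adicCompletion L)).toMonoidHom)⁻¹] :
            Fin 3 → ((w.1.adicCompletion L)ˣ →* ℂˣ)) a).comp
          (Matrix.GeneralLinearGroup.det.comp (Pi.evalMonoidHom (fun a : Fin 3 => GL {i : Fin 3 // (id : Fin 3 → Fin 3) i = a} (w.1.adicCompletion L)) a))))).IntertwiningMap
      (π.comap (cmSplitEquiv L H' hH' hH'd v w hw).symm).ρ)
    (hq : Function.Surjective q) :
    IrrClass.mk π = (cmSplitPacket L H' hH' hH'd v w hw ν₀ χ' hν₀u hν₀c hχ'u hχ'c).πn := by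
  -- SPLIT-LQ on `GL₃(L_w)` at the transported representation `π ∘ cmSplitEquiv⁻¹`: an equivalence with `(ν₀ ∘ det₂) × χ′ = (splitMemberGL …).ρ`
  obtain ⟨e⟩ := hLQ (w.1.adicCompletion L) ν₀ χ' hν₀u hν₀c hχ'u hχ'c _ (π.comap (cmSplitEquiv L H' hH' hH'd v w hw).symm).ρ q hq
  have h2 : IrrClass.mk (π.comap (cmSplitEquiv L H' hH' hH'd v w hw).symm) =
      IrrClass.mk (splitMemberGL (w.1.adicCompletion L) ν₀ χ' hν₀u hν₀c hχ'u hχ'c) :=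
    IrrClass.mk_eq_mk_of_equiv (r₂ := splitMemberGL (w.1.adicCompletion L) ν₀ χ' hν₀u hν₀c hχ'u hχ'c) e
  calc IrrClass.mk π
      = IrrClass.comap (cmSplitEquiv L H' hH' hH'd v w hw) (IrrClass.comap (cmSplitEquiv L H' hH' hH'd v w hw).symm (IrrClass.mk π)) :=
        (IrrClass.comap_comap_symm _ _).symm
    _ = IrrClass.comap (cmSplitEquiv L H' hH' hH'd v w hw) (IrrClass.mk (splitMemberGL (w.1.adicCompletion L) ν₀ χ' hν₀u hν₀c hχ'u hχ'c)) := by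
        rw [IrrClass.comap_mk, h2]
    _ = (cmSplitPacket L H' hH' hH'd v w hw ν₀ χ' hν₀u hν₀c hχ'u hχ'c).πn := by
        rw [IrrClass.comap_mk, cmSplitPacket_πn]

/-- **CONSUMER SHAPE, membership form (the (SPLIT) letter's conclusion)**: under SPLIT-LQ, such a `π` lies in the split packet: `⟦π⟧ ∈ Π(ξ_v).members` (the packet is the
singleton `{πn}`, ★ `cmSplitPacket_members`).  The (M) FILE 1 payer feeds `q` from «the local component at a split `v` of the residual block is an irreducible quotient of the
principal series at the residual exponent» (its RES-INT ∕ ORIENT ∕ isotypic letters). [cite: Rogawski1990, §13.1 p. 199; Lemma 4.13.1 (b)] [cite: Zelevinsky1980, Thm. 6.1 (a)] -/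
theorem irrClass_mk_mem_cmSplitPacket_members_of_oneLinkQuotient
    (ν₀ χ' : (w.1.adicCompletion L)ˣ →* ℂˣ) (hν₀u : ∀ x, ‖((ν₀ x : ℂˣ) : ℂ)‖ = 1) (hν₀c : Continuous fun x => ((ν₀ x : ℂˣ) : ℂ))
    (hχ'u : ∀ x, ‖((χ' x : ℂˣ) : ℂ)‖ = 1) (hχ'c : Continuous fun x => ((χ' x : ℂˣ) : ℂ))
    (hLQ : Zelevinsky1980.parabolicIndGL_three_oneLink_quotient_equiv_detChar)
    (π : SmoothIrrep ((UnitaryGroup.cmDatum L 3 H').Local v))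
    (q : (Representation.parabolicIndGL (w.1.adicCompletion L) (id : Fin 3 → Fin 3)
      ((Representation.trivial ℂ (Π a : Fin 3, GL {i : Fin 3 // (id : Fin 3 → Fin 3) i = a} (w.1.adicCompletion L)) ℂ).twist
        (∏ a : Fin 3, ((![ν₀ * ((unramifiedTwist (w.1.adicCompletion L) (1 / 2) : QuasiChar (w.1.adicCompletion L)).toMonoidHom), χ',
              ν₀ * ((unramifiedTwist (w.1.adicCompletion L) (1 / 2) : QuasiChar (w.1.adicCompletion L)).toMonoidHom)⁻¹] :
            Fin 3 → ((w.1.adicCompletion L)ˣ →* ℂˣ)) a).comp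
          (Matrix.GeneralLinearGroup.det.comp (Pi.evalMonoidHom (fun a : Fin 3 => GL {i : Fin 3 // (id : Fin 3 → Fin 3) i = a} (w.1.adicCompletion L)) a))))).IntertwiningMap
      (π.comap (cmSplitEquiv L H' hH' hH'd v w hw).symm).ρ)
    (hq : Function.Surjective q) :
    IrrClass.mk π ∈ (cmSplitPacket L H' hH' hH'd v w hw ν₀ χ' hν₀u hν₀c hχ'u hχ'c).members := by
  rw [cmSplitPacket_members, irrClass_mk_eq_cmSplitPacket_πn_of_oneLinkQuotient L H' hH' hH'd v w hw ν₀ χ' hν₀u hν₀c hχ'u hχ'c hLQ π q hq]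
  exact Set.mem_singleton _

end CM

end Summit.HodgeConjecture.HodgeConjecture.R90.S8

end
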